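import Literature.NumberTheory.LFunctions.TaoLogElliottProp24
import Literature.NumberTheory.LFunctions.MatomakiRadziwillTaoTheorem17
import Literature.NumberTheory.LFunctions.MatomakiRadziwillTaoPropA3
import HarnessLib

/-!
# Tao 2016, Proposition 2.4: its single named-fact frontier in the tree

Topic `Literature/NumberTheory/LFunctions`.  The named fact
`Literature.NumberTheory.LFunctions.Tao2016_prop24` (T. Tao, Forum Math. Pi 4 (2016) e8,
Proposition 2.4: under the non-pretentiousness hypothesis (2.7) the log-averaged short exponential
sums of `g₁` obey (2.10) at all scales `H₀ ≤ H ≤ H₊`; the only place where the proof of Theorem 2.3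
uses (2.7)) is proved in the tree from Matomäki–Radziwiłł–Tao 2015, Theorem 1.7
(`Tao2016_prop24_of_MRT`, `TaoLogElliottProp24.lean`, following the printed proof "Applying [MRT]
(with `W := log⁵ H`) … averaging this estimate for `X` between `x/2ω` and `2x`", with the dyadic
bookkeeping and the transfer of (2.7) from height `x` to the heights `X ≥ x^θ` made explicit).
Theorem 1.7 is in turn proved from MRT 2015, Theorem A.2
(`MRT2015.MatomakiRadziwillTao2015_theorem17_of_theoremA2`, `MatomakiRadziwillTaoTheorem17.lean`),
and Theorem A.2 from Proposition A.3 (`MatomakiRadziwillTao2015_theoremA2_of_propA3`,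
`MatomakiRadziwillTaoPropA3.lean`).  This file records the two resulting one-line compositions, so
that the dependence of Proposition 2.4 on the single remaining named fact
`Literature.NumberTheory.LFunctions.MatomakiRadziwillTao2015_propA3` (the complex
Matomäki–Radziwiłł mean-value theorem, MRT 2015, Appendix A, Proposition A.3) is a theorem of the
tree; the discharge `Tao2016_prop24_holds` is then `Tao2016_prop24_of_propA3 ‹_›` once that fact is
discharged.  (The sibling file `TaoLogChowlaOfTheoremA2.lean` records the same compositions for
Theorem 2.3, Theorem 1.3 and Theorem 1.2.)

## References
* T. Tao, *The logarithmically averaged Chowla and Elliott conjectures for two-point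
  correlations*, Forum Math. Pi 4 (2016), e8; arXiv:1509.05422: Proposition 2.4 and its proof
  (the remark following it: "Proposition 2.4 is the only way in which we will take advantage of
  the hypothesis (2.7)").
* K. Matomäki, M. Radziwiłł, T. Tao, *An averaged form of Chowla's conjecture*, Algebra & Number
  Theory 9 (2015), 2167–2196; arXiv:1503.05121: Theorem 1.7, Appendix A (Theorem A.2,
  Proposition A.3).
-/

namespace Literature.NumberTheory.LFunctions

/-- **Tao 2016, Proposition 2.4, from MRT 2015, Theorem A.2**: the named fact `Tao2016_prop24`
(the bound (2.10) on the log-averaged short exponential sums of `g₁` under hypothesis (2.7)) follows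
from the complex Matomäki–Radziwiłł theorem `MatomakiRadziwillTao2015_theoremA2`, via MRT 2015,
Theorem 1.7 (`MRT2015.MatomakiRadziwillTao2015_theorem17_of_theoremA2`) and the printed proof of
Proposition 2.4 (`Tao2016_prop24_of_MRT`). [cite: TaoFMP2016, Proposition 2.4] -/
theorem Tao2016_prop24_of_theoremA2 (hA2 : MatomakiRadziwillTao2015_theoremA2) : Tao2016_prop24 :=
  Tao2016_prop24_of_MRT (MRT2015.MatomakiRadziwillTao2015_theorem17_of_theoremA2 hA2)

/-- **Tao 2016, Proposition 2.4, from MRT 2015, Proposition A.3**: the named fact `Tao2016_prop24`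
follows from the single named fact `MatomakiRadziwillTao2015_propA3` (everything in between —
MRT 2015 Theorem A.2, Lemma 2.2, §§3–4, Proposition 2.4, Theorem 2.3, Theorem 1.7, and Tao's
dyadic/log-averaging argument — being proved in the tree). [cite: TaoFMP2016, Proposition 2.4] -/
theorem Tao2016_prop24_of_propA3 (hA3 : MatomakiRadziwillTao2015_propA3) : Tao2016_prop24 :=
  Tao2016_prop24_of_theoremA2 (MatomakiRadziwillTao2015_theoremA2_of_propA3 hA3)

end Literature.NumberTheory.LFunctions
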